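import Summits.KontsevichZagierPeriods.KontsevichZagierPeriods.Theorems.K2SymbolChainsJensenIsScissorsKLemma
import Summits.KontsevichZagierPeriods.KontsevichZagierPeriods.Theorems.K2SymbolChainsJensenIsScissorsMeasure

/-!
# Jensen is scissors — the signed product rule `log (V₁ V₂) ~ log V₁ + log V₂`

Support file for item stmt-KontsevichZagierPeriods-5204 (`JensenIsScissors`, route
KontsevichZagierPeriods/K2SymbolChains). With `L(T, G, W)` the signed unfolding of `G · log W` over
`T` (`KZ.logUnfoldDomain` / `KZ.logUnfoldIntegrand`), for `V₁, V₂ > 0` `ℚ`-semialgebraic and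
differentiable at the points of the `ℚ`-semialgebraic base `T`, `G` `ℚ`-semialgebraic with `G`,
`G log V₁`, `G log V₂` absolutely integrable on `T`, and any subgroup `S` containing the three
scissors move sets:

  `[L(T, G, V₁ V₂)] − [L(T, G, V₁)] − [L(T, G, V₂)] ∈ S`     (`of_logUnfold_prod_sub_sub_mem`).

Proof: with `Kᵢ = 1 + 1/Vᵢ ≥ 1` (so `Kᵢ Vᵢ = Vᵢ + 1 ≥ 1`) the dilation lemma
`of_logUnfold_mul_sub_sub_mem` (`log (K V) ~ log K + log V` for `K ≥ 1`, `K V ≥ 1`) is applied to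
`(K₁K₂, V₁V₂)`, `(K₁, K₂)`, `(K₁V₁, K₂V₂)`, `(K₁, V₁)`, `(K₂, V₂)`; the six auxiliary unfoldings
`L(Kᵢ)`, `L(Kᵢ Vᵢ)`, `L(K₁K₂)`, `L(K₁K₂V₁V₂)` exist because `0 ≤ log Kᵢ, log (1 + Vᵢ) ≤
log 2 + |log Vᵢ|`. No Newton–Leibniz move is used.
[Kontsevich–Zagier 2001, §1.1–1.2, rules 1)–2)] [folklore]
-/

noncomputable section

open MeasureTheory Set
open Literature.NumberTheory.Transcendental Literature.ModelTheory.ExponentialFields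

namespace Summit.KontsevichZagierPeriods.K2SymbolChains.JensenIsScissorsProof

open Literature.NumberTheory.Transcendental.KZ

variable {m : ℕ} {S : AddSubgroup FormalRep}

/-! ### Integrability of `G log W` from a bound `|log W| ≤ B` -/

/-- If `|log W| ≤ 2 log 2 + |log V₁| + |log V₂|` on `T` and `G`, `G log V₁`, `G log V₂` are
integrable on `T` (all functions `ℚ`-semialgebraic on `T`), then `G log W` is integrable on `T`.
[folklore] -/
theorem integrableOn_mul_log_of_bound {T : Set (Fin m → ℝ)} {G V₁ V₂ W : (Fin m → ℝ) → ℝ}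
    (hT : IsSemialgebraic ℚ T) (hG : IsSemialgebraicFunOn ℚ T G) (hW : IsSemialgebraicFunOn ℚ T W)
    (hbound : ∀ b ∈ T, |Real.log (W b)| ≤ 2 * Real.log 2 + |Real.log (V₁ b)| + |Real.log (V₂ b)|)
    (hGi : IntegrableOn G T) (h1 : IntegrableOn (fun b => G b * Real.log (V₁ b)) T)
    (h2 : IntegrableOn (fun b => G b * Real.log (V₂ b)) T) :
    IntegrableOn (fun b => G b * Real.log (W b)) T := by
  have hTm : MeasurableSet T := IsSemialgebraic.measurableSet_holds hT
  have hmeas : AEStronglyMeasurable (fun b => G b * Real.log (W b)) (volume.restrict T) :=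
    (aestronglyMeasurable_of_isSemialgebraicFunOn hG hTm).mul
      (Real.measurable_log.comp_aemeasurable
        (aestronglyMeasurable_of_isSemialgebraicFunOn hW hTm).aemeasurable).aestronglyMeasurable
  have hg : IntegrableOn (fun b => (2 * Real.log 2) * ‖G b‖ + ‖G b * Real.log (V₁ b)‖ +
      ‖G b * Real.log (V₂ b)‖) T :=
    ((hGi.norm.const_mul _).add h1.norm).add h2.norm
  refine Integrable.mono' hg hmeas ((ae_restrict_mem hTm).mono fun b hb => ?_)
  rw [norm_mul, norm_mul, norm_mul, Real.norm_eq_abs, Real.norm_eq_abs, Real.norm_eq_abs,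
    Real.norm_eq_abs]
  have hG0 := abs_nonneg (G b)
  calc |G b| * |Real.log (W b)| ≤ |G b| * (2 * Real.log 2 + |Real.log (V₁ b)| + |Real.log (V₂ b)|) :=
        mul_le_mul_of_nonneg_left (hbound b hb) hG0
    _ = 2 * Real.log 2 * |G b| + |G b| * |Real.log (V₁ b)| + |G b| * |Real.log (V₂ b)| := by ring

/-- `0 ≤ log (1 + 1/v) ≤ log 2 + |log v|` for `v > 0`. [folklore] -/
theorem abs_log_one_add_inv_le {v : ℝ} (hv : 0 < v) :
    |Real.log (1 + v⁻¹)| ≤ Real.log 2 + |Real.log v| := by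
  have h1 : 1 ≤ 1 + v⁻¹ := by have := inv_pos.2 hv; linarith
  rw [abs_of_nonneg (Real.log_nonneg h1)]
  rcases le_or_gt 1 v with hv1 | hv1
  · have : 1 + v⁻¹ ≤ 2 := by have := inv_le_one_of_one_le₀ hv1; linarith
    calc Real.log (1 + v⁻¹) ≤ Real.log 2 := Real.log_le_log (by positivity) this
      _ ≤ Real.log 2 + |Real.log v| := le_add_of_nonneg_right (abs_nonneg _)
  · have hle : 1 + v⁻¹ ≤ 2 * v⁻¹ := by
      have : 1 ≤ v⁻¹ := (one_le_inv₀ hv).2 hv1.le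
      linarith
    calc Real.log (1 + v⁻¹) ≤ Real.log (2 * v⁻¹) := Real.log_le_log (by positivity) hle
      _ = Real.log 2 + -Real.log v := by rw [Real.log_mul (by norm_num) (by positivity), Real.log_inv]
      _ ≤ Real.log 2 + |Real.log v| := by gcongr; exact neg_le_abs _

/-- `0 ≤ log (1 + v) ≤ log 2 + |log v|` for `v > 0`. [folklore] -/
theorem abs_log_one_add_le {v : ℝ} (hv : 0 < v) :
    |Real.log (1 + v)| ≤ Real.log 2 + |Real.log v| := by
  have h := abs_log_one_add_inv_le (inv_pos.2 hv)
  rwa [inv_inv, Real.log_inv, abs_neg] at h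

/-! ### The signed product rule -/

/-- **The signed product rule inside `S`.** For `V₁, V₂ > 0` on `T` (all data `ℚ`-semialgebraic,
`Vᵢ` differentiable at the points of `T`, `G`, `G log V₁`, `G log V₂` integrable on `T`) and
representations `R₁₂`, `R₁`, `R₂` with the signed unfolding domains of `log (V₁V₂)`, `log V₁`,
`log V₂` over `T` and integrand `±G/u`: `[R₁₂] − [R₁] − [R₂] ∈ S`.
[Kontsevich–Zagier 2001, §1.1–1.2, rules 1)–2)] [folklore] -/
theorem of_logUnfold_prod_sub_sub_mem
    (hS : domainAddRel ∪ integrandAddRel ∪ changeOfVariablesRel ⊆ S)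
    {T : Set (Fin m → ℝ)} {G V₁ V₂ : (Fin m → ℝ) → ℝ} (hT : IsSemialgebraic ℚ T)
    (hG : IsSemialgebraicFunOn ℚ T G) (hV₁ : IsSemialgebraicFunOn ℚ T V₁)
    (hV₂ : IsSemialgebraicFunOn ℚ T V₂) (hV₁0 : ∀ b ∈ T, 0 < V₁ b) (hV₂0 : ∀ b ∈ T, 0 < V₂ b)
    (hV₁d : ∀ b ∈ T, DifferentiableAt ℝ V₁ b) (hV₂d : ∀ b ∈ T, DifferentiableAt ℝ V₂ b)
    (hGi : IntegrableOn G T) (hGV₁ : IntegrableOn (fun b => G b * Real.log (V₁ b)) T)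
    (hGV₂ : IntegrableOn (fun b => G b * Real.log (V₂ b)) T)
    (R₁₂ R₁ R₂ : IntegralRep (m + 1))
    (h₁₂d : R₁₂.domain = logUnfoldDomain T (fun b => V₁ b * V₂ b))
    (h₁₂i : EqOn R₁₂.integrand (logUnfoldIntegrand G) R₁₂.domain)
    (h₁d : R₁.domain = logUnfoldDomain T V₁) (h₁i : EqOn R₁.integrand (logUnfoldIntegrand G) R₁.domain)
    (h₂d : R₂.domain = logUnfoldDomain T V₂) (h₂i : EqOn R₂.integrand (logUnfoldIntegrand G) R₂.domain) :
    of R₁₂ - of R₁ - of R₂ ∈ S := by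
  -- the multipliers `Kᵢ = 1 + 1/Vᵢ`
  set K₁ : (Fin m → ℝ) → ℝ := fun b => 1 + (V₁ b)⁻¹ with hK₁_def
  set K₂ : (Fin m → ℝ) → ℝ := fun b => 1 + (V₂ b)⁻¹ with hK₂_def
  have hK₁s : IsSemialgebraicFunOn ℚ T K₁ :=
    IsSemialgebraicFunOn.add_holds (by simpa using isSemialgebraicFunOn_ratCast hT 1)
      (hV₁.inv fun b hb => (hV₁0 b hb).ne')
  have hK₂s : IsSemialgebraicFunOn ℚ T K₂ :=
    IsSemialgebraicFunOn.add_holds (by simpa using isSemialgebraicFunOn_ratCast hT 1)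
      (hV₂.inv fun b hb => (hV₂0 b hb).ne')
  have hK₁1 : ∀ b ∈ T, 1 ≤ K₁ b := fun b hb => by
    have := inv_pos.2 (hV₁0 b hb); simp only [hK₁_def]; linarith
  have hK₂1 : ∀ b ∈ T, 1 ≤ K₂ b := fun b hb => by
    have := inv_pos.2 (hV₂0 b hb); simp only [hK₂_def]; linarith
  have hK₁V₁ : ∀ b ∈ T, K₁ b * V₁ b = 1 + V₁ b := fun b hb => by
    simp only [hK₁_def]; field_simp [(hV₁0 b hb).ne']; ring
  have hK₂V₂ : ∀ b ∈ T, K₂ b * V₂ b = 1 + V₂ b := fun b hb => by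
    simp only [hK₂_def]; field_simp [(hV₂0 b hb).ne']; ring
  have hK₁d : ∀ b ∈ T, DifferentiableAt ℝ K₁ b := fun b hb =>
    (differentiableAt_const _).add ((hV₁d b hb).inv (hV₁0 b hb).ne')
  have hK₂d : ∀ b ∈ T, DifferentiableAt ℝ K₂ b := fun b hb =>
    (differentiableAt_const _).add ((hV₂d b hb).inv (hV₂0 b hb).ne')
  -- positivity / `≥ 1` facts
  have hK₁pos : ∀ b ∈ T, 0 < K₁ b := fun b hb => one_pos.trans_le (hK₁1 b hb)
  have hK₂pos : ∀ b ∈ T, 0 < K₂ b := fun b hb => one_pos.trans_le (hK₂1 b hb)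
  have hKV₁1 : ∀ b ∈ T, 1 ≤ K₁ b * V₁ b := fun b hb => by rw [hK₁V₁ b hb]; linarith [hV₁0 b hb]
  have hKV₂1 : ∀ b ∈ T, 1 ≤ K₂ b * V₂ b := fun b hb => by rw [hK₂V₂ b hb]; linarith [hV₂0 b hb]
  have hKK1 : ∀ b ∈ T, 1 ≤ K₁ b * K₂ b := fun b hb => by nlinarith [hK₁1 b hb, hK₂1 b hb]
  -- bounds on the logarithms
  have hlog2 : 0 ≤ Real.log 2 := Real.log_nonneg (by norm_num)
  have bK₁ : ∀ b ∈ T, |Real.log (K₁ b)| ≤ 2 * Real.log 2 + |Real.log (V₁ b)| + |Real.log (V₂ b)| :=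
    fun b hb => by
      have := abs_log_one_add_inv_le (hV₁0 b hb)
      have := abs_nonneg (Real.log (V₂ b))
      simp only [hK₁_def]; linarith
  have bK₂ : ∀ b ∈ T, |Real.log (K₂ b)| ≤ 2 * Real.log 2 + |Real.log (V₁ b)| + |Real.log (V₂ b)| :=
    fun b hb => by
      have := abs_log_one_add_inv_le (hV₂0 b hb)
      have := abs_nonneg (Real.log (V₁ b))
      simp only [hK₂_def]; linarith
  have bKV₁ : ∀ b ∈ T, |Real.log (K₁ b * V₁ b)| ≤
      2 * Real.log 2 + |Real.log (V₁ b)| + |Real.log (V₂ b)| := fun b hb => by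
    rw [hK₁V₁ b hb]
    have := abs_log_one_add_le (hV₁0 b hb)
    have := abs_nonneg (Real.log (V₂ b))
    linarith
  have bKV₂ : ∀ b ∈ T, |Real.log (K₂ b * V₂ b)| ≤
      2 * Real.log 2 + |Real.log (V₁ b)| + |Real.log (V₂ b)| := fun b hb => by
    rw [hK₂V₂ b hb]
    have := abs_log_one_add_le (hV₂0 b hb)
    have := abs_nonneg (Real.log (V₁ b))
    linarith
  have bKK : ∀ b ∈ T, |Real.log (K₁ b * K₂ b)| ≤
      2 * Real.log 2 + |Real.log (V₁ b)| + |Real.log (V₂ b)| := fun b hb => by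
    rw [Real.log_mul (hK₁pos b hb).ne' (hK₂pos b hb).ne']
    have h1 := abs_log_one_add_inv_le (hV₁0 b hb)
    have h2 := abs_log_one_add_inv_le (hV₂0 b hb)
    have := abs_add_le (Real.log (K₁ b)) (Real.log (K₂ b))
    simp only [hK₁_def, hK₂_def] at *
    linarith
  have bAll : ∀ b ∈ T, |Real.log ((K₁ b * K₂ b) * (V₁ b * V₂ b))| ≤
      2 * Real.log 2 + |Real.log (V₁ b)| + |Real.log (V₂ b)| := fun b hb => by
    rw [show (K₁ b * K₂ b) * (V₁ b * V₂ b) = (K₁ b * V₁ b) * (K₂ b * V₂ b) by ring,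
      Real.log_mul (by nlinarith [hKV₁1 b hb]) (by nlinarith [hKV₂1 b hb]), hK₁V₁ b hb, hK₂V₂ b hb]
    have h1 := abs_log_one_add_le (hV₁0 b hb)
    have h2 := abs_log_one_add_le (hV₂0 b hb)
    have := abs_add_le (Real.log (1 + V₁ b)) (Real.log (1 + V₂ b))
    linarith
  -- semialgebraicity of the products
  have hKV₁s : IsSemialgebraicFunOn ℚ T (fun b => K₁ b * V₁ b) := IsSemialgebraicFunOn.mul_holds hK₁s hV₁
  have hKV₂s : IsSemialgebraicFunOn ℚ T (fun b => K₂ b * V₂ b) := IsSemialgebraicFunOn.mul_holds hK₂s hV₂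
  have hKKs : IsSemialgebraicFunOn ℚ T (fun b => K₁ b * K₂ b) := IsSemialgebraicFunOn.mul_holds hK₁s hK₂s
  have hVVs : IsSemialgebraicFunOn ℚ T (fun b => V₁ b * V₂ b) := IsSemialgebraicFunOn.mul_holds hV₁ hV₂
  have hAlls : IsSemialgebraicFunOn ℚ T (fun b => (K₁ b * K₂ b) * (V₁ b * V₂ b)) :=
    IsSemialgebraicFunOn.mul_holds hKKs hVVs
  -- the auxiliary representations
  have hZ : ∀ {W : (Fin m → ℝ) → ℝ}, (∀ b ∈ T, 1 ≤ W b) → volume {b | b ∈ T ∧ W b = 0} = 0 :=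
    fun hW => by
      rw [show {b | b ∈ T ∧ _} = (∅ : Set (Fin m → ℝ)) by
        ext b; simp only [mem_setOf_eq, mem_empty_iff_false, iff_false, not_and]
        intro hb h0; have := hW b hb; linarith]
      exact measure_empty
  have mk : ∀ {W : (Fin m → ℝ) → ℝ}, IsSemialgebraicFunOn ℚ T W → (∀ b ∈ T, 1 ≤ W b) →
      (∀ b ∈ T, |Real.log (W b)| ≤ 2 * Real.log 2 + |Real.log (V₁ b)| + |Real.log (V₂ b)|) →
      ∃ R : IntegralRep (m + 1), R.domain = logUnfoldDomain T W ∧ R.integrand = logUnfoldIntegrand G :=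
    fun hW hW1 hWb =>
      ⟨logUnfoldRep T _ G hT hG hW (fun b hb => zero_le_one.trans (hW1 b hb)) (hZ hW1)
        (integrableOn_mul_log_of_bound hT hG hW hWb hGi hGV₁ hGV₂), rfl, rfl⟩
  obtain ⟨LK₁, dK₁, iK₁⟩ := mk hK₁s hK₁1 bK₁
  obtain ⟨LK₂, dK₂, iK₂⟩ := mk hK₂s hK₂1 bK₂
  obtain ⟨LKV₁, dKV₁, iKV₁⟩ := mk hKV₁s hKV₁1 bKV₁
  obtain ⟨LKV₂, dKV₂, iKV₂⟩ := mk hKV₂s hKV₂1 bKV₂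
  obtain ⟨LKK, dKK, iKK⟩ := mk hKKs hKK1 bKK
  have hAll1 : ∀ b ∈ T, 1 ≤ (K₁ b * K₂ b) * (V₁ b * V₂ b) := fun b hb => by
    rw [show (K₁ b * K₂ b) * (V₁ b * V₂ b) = (K₁ b * V₁ b) * (K₂ b * V₂ b) by ring]
    nlinarith [hKV₁1 b hb, hKV₂1 b hb]
  obtain ⟨LAll, dAll, iAll⟩ := mk hAlls hAll1 bAll
  -- (a) `(K₁K₂, V₁V₂)`
  have ea : of LAll - of LKK - of R₁₂ ∈ S :=
    of_logUnfold_mul_sub_sub_mem hS (K := fun b => K₁ b * K₂ b) (V := fun b => V₁ b * V₂ b) hT hKKs hVVs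
      hKK1 (fun b hb => mul_pos (hV₁0 b hb) (hV₂0 b hb)) hAll1
      (fun b hb => (hK₁d b hb).mul (hK₂d b hb)) LAll LKK R₁₂ dAll (by rw [iAll]; exact fun _ _ => rfl)
      dKK (by rw [iKK]; exact fun _ _ => rfl) h₁₂d h₁₂i
  -- (b) `(K₁, K₂)`
  have eb : of LKK - of LK₁ - of LK₂ ∈ S :=
    of_logUnfold_mul_sub_sub_mem hS (K := K₁) (V := K₂) hT hK₁s hK₂s hK₁1 hK₂pos hKK1 hK₁d LKK LK₁ LK₂
      dKK (by rw [iKK]; exact fun _ _ => rfl) dK₁ (by rw [iK₁]; exact fun _ _ => rfl)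
      dK₂ (by rw [iK₂]; exact fun _ _ => rfl)
  -- (c) `(K₁V₁, K₂V₂)`
  have ec : of LAll - of LKV₁ - of LKV₂ ∈ S :=
    of_logUnfold_mul_sub_sub_mem hS (K := fun b => K₁ b * V₁ b) (V := fun b => K₂ b * V₂ b) hT hKV₁s hKV₂s
      hKV₁1 (fun b hb => one_pos.trans_le (hKV₂1 b hb)) (fun b hb => by nlinarith [hKV₁1 b hb, hKV₂1 b hb])
      (fun b hb => (hK₁d b hb).mul (hV₁d b hb)) LAll LKV₁ LKV₂
      (by rw [dAll]; congr 1; funext b; ring) (by rw [iAll]; exact fun _ _ => rfl)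
      dKV₁ (by rw [iKV₁]; exact fun _ _ => rfl) dKV₂ (by rw [iKV₂]; exact fun _ _ => rfl)
  -- (d), (e) `(Kᵢ, Vᵢ)`
  have ed : of LKV₁ - of LK₁ - of R₁ ∈ S :=
    of_logUnfold_mul_sub_sub_mem hS (K := K₁) (V := V₁) hT hK₁s hV₁ hK₁1 hV₁0 hKV₁1 hK₁d LKV₁ LK₁ R₁
      dKV₁ (by rw [iKV₁]; exact fun _ _ => rfl) dK₁ (by rw [iK₁]; exact fun _ _ => rfl) h₁d h₁i
  have ee : of LKV₂ - of LK₂ - of R₂ ∈ S :=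
    of_logUnfold_mul_sub_sub_mem hS (K := K₂) (V := V₂) hT hK₂s hV₂ hK₂1 hV₂0 hKV₂1 hK₂d LKV₂ LK₂ R₂
      dKV₂ (by rw [iKV₂]; exact fun _ _ => rfl) dK₂ (by rw [iK₂]; exact fun _ _ => rfl) h₂d h₂i
  have : of R₁₂ - of R₁ - of R₂ = (of LKV₁ - of LK₁ - of R₁) + (of LKV₂ - of LK₂ - of R₂) +
      (of LAll - of LKV₁ - of LKV₂) - (of LKK - of LK₁ - of LK₂) - (of LAll - of LKK - of R₁₂) := by
    abel
  rw [this]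
  exact S.sub_mem (S.sub_mem (S.add_mem (S.add_mem ed ee) ec) eb) ea

end Summit.KontsevichZagierPeriods.K2SymbolChains.JensenIsScissorsProof
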